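import Mathlib
import HarnessLib
import Summits.HubbardSuperconductivity.HubbardSuperconductivity.Theorems.KLProgrammeKLRegimeEngineTowerRemeasureSplitKlEng

/-!
# Route `KLProgramme` — crux K3 ENGINE (stmt-HubbardSuperconductivity-20437 `KLRegimeEngineV17F2`), stub (b) v2, THE LEVELS PACKAGE (ℓ), instantiation (I2):
# THE LEVELLED SPLIT JUMP WITH AN m-UNIFORM CONSTANT (located item «(I2)-CONST-UNIFORM», prep for the `F = 1` track of «(I2)-KIT-HMU-LEV»; cell gate-hubbard-kl, seat p4 g17)

`klLevNormOf_jump_le_split_klEng (m)` (k3c2-p3, …RemeasureSplitKlEng) is typed `∃ C` per degree although its proof takes `C = (3CJ/2)^{m+1}` with the m-free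
overlap constant `CJ` of `overlap_jump_sums_klEng`; the kit needs the geometric form.  Same proof, `m` moved inside:

* **`klLevNormOf_jump_le_split_klEng_uniform`** — `∃ C₀ > 0, ∀ m, (binders verbatim) → klLevNormOf … J′ (m+1) T Ωe ≤ C₀^{m+1}·(A₁·N + A₂·N_B)` (`C₀ = 3CJ/2`).
Composition of landed theorems; nothing about the model is asserted beyond them; nothing asserts (ℓ), any stub, K3 or superconductivity.
References: BGM 2006 §2.8 (2.82)–(2.84), (2.88)–(2.90), App. A3 [cite: BenfattoGiulianiMastropietro2006].
-/

noncomputable section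

namespace Summit.HubbardSuperconductivity.HubbardSuperconductivity.Theorems.EngineV8

set_option linter.dupNamespace false -- summit = problem name (single-conjunct summit), D-0017

open Classical
open Real Finset Literature.MathematicalPhysics.QuantumLattice Literature.Probability.LatticeModels GrassmannAlgebra
open Literature.Probability.LatticeModels.BattleFederbush
open Literature.MathematicalPhysics.QuantumLattice.FermiRG
open Summit.HubbardSuperconductivity.HubbardSuperconductivity.Theorems.KLRegimeSplit
open Summit.HubbardSuperconductivity.HubbardSuperconductivity.Theorems.KLProgrammeLegKernels
open Summit.HubbardSuperconductivity.HubbardSuperconductivity.Theorems.DispersionFlow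
open Summit.HubbardSuperconductivity.HubbardSuperconductivity.Theorems.KLRegimeWick
open Summit.HubbardSuperconductivity.HubbardSuperconductivity.Theorems.TorusFourierL2

/-- **THE LEVELLED SPLIT JUMP UNDER THE STUB BINDERS, m-UNIFORM CONSTANT** (twin of `klLevNormOf_jump_le_split_klEng`): `C₀ = 3CJ/2` fixed before the degree;
for every `m`, class `B`, abstract split counts `A₁/A₂`: `klLevNormOf … J′ (m+1) T Ωe ≤ C₀^{m+1}·(A₁·N + A₂·N_B)`.
[cite: BenfattoGiulianiMastropietro2006, §2.8 (2.82)-(2.84), (2.88)-(2.90), App. A3] -/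
theorem klLevNormOf_jump_le_split_klEng_uniform :
    ∃ C₀ : ℝ, 0 < C₀ ∧ ∀ (m : ℕ) (P : SplitConsts) (R : RenConsts) (c : ℝ), P.WF → R.WF2 → 0 < c → c ≤ klEngC₃6 P R →
      ∀ μ ∈ klWindowC, ∀ U : ℝ, 0 < U → U ≤ klEngU₀9 P R c → ∀ β : ℝ, klBetaMin ≤ β → β ≤ Real.exp (c / U ^ 2) →
      ∀ K : TrigPolyC4v, FrameOK R U (nScales β) μ K → ∀ (L M : ℕ) [NeZero L] [NeZero M],
      klEngL₃ β U ≤ L → klEngM₃ β U L ≤ M → ∀ k J' : ℕ, k + 1 ≤ J' → J' ≤ nScales β + 1 →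
      ∀ T : HubbardGrassmann L M,
        (∀ (m' : ℕ) (X : Fin m' → HubbardFieldIdx L M), ∑ i, signedMomentum L (X i).2 (X i).1.1.2 ≠ 0 → kernel ℂ T m' X = 0) →
      ∀ (B : Finset (Fin (m + 1) → SectorLeg (sectorCount k))) (Ωe : Fin (m + 1) → Option (SectorLeg (sectorCount J')))
        (A₁ A₂ N NB : ℝ), 0 ≤ A₁ → 0 ≤ A₂ → 0 ≤ N → 0 ≤ NB →
        (∀ (E : Finset (Fin (m + 1))) (τ'' : Fin (m + 1) → SectorLeg (sectorCount J')) (σ' : Fin (m + 1) → SectorLeg (sectorCount k)),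
          σ' ∉ B → levelCount Ωe ≤ E.card → E.card ≤ levelCount Ωe + 1 →
          (27 : ℝ) ^ E.card * ((((bgmSectorSet L M (klAnisoFamily L M β μ K klE0 J') (m + 1)).filter fun σ'' => (∀ e ∈ E, σ'' e = τ'' e) ∧ ∀ i,
            (∃ q : FreqMomentum L M, klAnisoFamily L M β μ K klE0 J' (σ'' i).1.1 q ≠ 0 ∧
              bgmFatMultiplier L M klE0 β (nambuXiCT L μ K) k (σ' i).1.1 q ≠ 0) ∧
            (σ' i).1.2 = (σ'' i).1.2 ∧ (σ' i).2 = (σ'' i).2).card : ℝ)) ≤ A₁) →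
        (∀ (E : Finset (Fin (m + 1))) (τ'' : Fin (m + 1) → SectorLeg (sectorCount J')) (σ' : Fin (m + 1) → SectorLeg (sectorCount k)),
          σ' ∈ B → levelCount Ωe ≤ E.card → E.card ≤ levelCount Ωe + 1 →
          (27 : ℝ) ^ E.card * ((((bgmSectorSet L M (klAnisoFamily L M β μ K klE0 J') (m + 1)).filter fun σ'' => (∀ e ∈ E, σ'' e = τ'' e) ∧ ∀ i,
            (∃ q : FreqMomentum L M, klAnisoFamily L M β μ K klE0 J' (σ'' i).1.1 q ≠ 0 ∧
              bgmFatMultiplier L M klE0 β (nambuXiCT L μ K) k (σ' i).1.1 q ≠ 0) ∧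
            (σ' i).1.2 = (σ'' i).1.2 ∧ (σ' i).2 = (σ'' i).2).card : ℝ)) ≤ A₂) →
        (∀ Ωe' : Fin (m + 1) → Option (SectorLeg (sectorCount k)), levelCount Ωe' = levelCount Ωe →
          klLevNormOf L M β μ K k (m + 1) T Ωe' ≤ N) →
        (∀ Ωe' : Fin (m + 1) → Option (SectorLeg (sectorCount k)), levelCount Ωe' = levelCount Ωe →
          hubbardSectorKernelNorm L M β (klAnisoFamily L M β μ K klE0 k) (prescribedTuples B Ωe') T ≤ NB) →
        klLevNormOf L M β μ K J' (m + 1) T Ωe ≤ C₀ ^ (m + 1) * (A₁ * N + A₂ * NB) := by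
  obtain ⟨CJ, hCJ, hov⟩ := overlap_jump_sums_klEng
  refine ⟨3 * CJ / 2, by positivity, ?_⟩
  intro m P R c hP hR2 hc hc6 μ hμ U hU hU9 β hβmin hβc K hK L M _ _ hL3 hM3 k J' hJ hJN T hT B Ωe A₁ A₂ N NB hA₁ hA₂ hN0 hNB0 hRoff hRon hN hNB
  have hβ : 0 < β := KLRegimeSplit.pos_of_klBetaMin_le hβmin
  obtain ⟨_, hcol₁, hrow₁⟩ := hov P R c hP hR2 hc hc6 μ hμ U hU hU9 β hβmin hβc K hK L M hL3 hM3 k J' hJ hJN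
  have hc₁0 : (0 : ℝ) ≤ 3 * CJ * M / β := by positivity
  have h := klLevNormOf_jump_le_split_of_consts hβ μ K hJ T hT hc₁0 hc₁0 hcol₁ hrow₁ m B Ωe hA₁ hA₂ hN0 hNB0 hRoff hRon hN hNB
  have hMne : (M : ℝ) ≠ 0 := by exact_mod_cast NeZero.ne M
  have hεc : imagTimeWeight β M * (3 * CJ * M / β) = 3 * CJ / 2 := by
    unfold imagTimeWeight; field_simp
  have hconst : (3 * CJ * M / β) ^ m * (3 * CJ * M / β) * imagTimeWeight β M ^ (m + 1) = (3 * CJ / 2) ^ (m + 1) := by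
    rw [← pow_succ, ← mul_pow, mul_comm (3 * CJ * M / β), hεc]
  calc klLevNormOf L M β μ K J' (m + 1) T Ωe
      ≤ (3 * CJ * M / β) ^ m * (3 * CJ * M / β) * imagTimeWeight β M ^ (m + 1) * (A₁ * N + A₂ * NB) := h
    _ = (3 * CJ / 2) ^ (m + 1) * (A₁ * N + A₂ * NB) := by rw [hconst]

end Summit.HubbardSuperconductivity.HubbardSuperconductivity.Theorems.EngineV8

end
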